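import Summits.MatrixMultiplication.MatrixMultiplication.Theorems.SoloBlindHypergraphRealise
import Summits.MatrixMultiplication.MatrixMultiplication.Theorems.SoloBlindHypergraphK3

/-!
# Realisation for (K₃): the Kraft inequality implies the balanced hypergraph Kraft conjecture

Sub-programme (K₃).  `SoloBlindHypergraphK3` proved (♦) ⟹ (K₃) (`soloBlind_kraft_of_hgKraftOne`); here the
converse, by the realisation of `SoloBlindHypergraphRealise`: a BALANCED hypergraph `(F, P)` (separating, and no
functional of total `0` has edge values meeting exactly one of `1`, `2`) is realised inside the representation
family of the target `σ = [s_{v₀}]` of the zero-sum-free sequence `J ↦ [e_J]` in `𝔽₃^{Finset W} ⧸ span{s_v - s_{v₀}}`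
(zero-sum freeness uses only the total-`0` clause: `soloBlind_realise_zsf`), so (K₃) at that target bounds the
Kraft sum by `1` (`soloBlind_hgKraftOne_of_kraft`).  Consequently (K₃) ⟺ (♦) (`soloBlind_kraft_iff_hgKraftOne`),
both directions in the kernel — the incidence-vector form of the Kraft inequality for zero-sum-free sequences.
-/

namespace Summit.MatrixMultiplication.MatrixMultiplication.Theorems

open Finset

universe u

variable {W : Type u} [DecidableEq W]

/-- Zero-sum freeness of the realising sequence from the total-`0` clause alone. -/
theorem soloBlind_realise_zsf {F : Finset W} {P : Finset (Finset W)} (hPF : ∀ J ∈ P, J ⊆ F) {v₀ : W}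
    (hv₀ : v₀ ∈ F)
    (h0 : ∀ c : W → ZMod 3, ∑ v ∈ F, c v = 0 →
      ((∃ J ∈ P, soloBlindHgVal c J = 1) ↔ (∃ J ∈ P, soloBlindHgVal c J = 2))) :
    ∀ T ⊆ P, T.Nonempty → ∑ J ∈ T, soloBlindRealise F P v₀ J ≠ 0 := by
  intro T hTP hTne hsum
  have hmem : soloBlindIndVec T ∈ soloBlindRelMod F P v₀ := by
    have := hsum
    rw [soloBlind_realise_sum, Submodule.mkQ_apply, Submodule.Quotient.mk_eq_zero] at this
    exact this
  obtain ⟨c, hc0, hcJ⟩ := soloBlind_relMod_functional hPF hv₀ hmem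
  obtain ⟨J₀, hJ₀⟩ := hTne
  have hone : ∃ J ∈ P, soloBlindHgVal c J = 1 :=
    ⟨J₀, hTP hJ₀, by rw [hcJ J₀ (hTP hJ₀)]; simp [soloBlindIndVec, hJ₀]⟩
  obtain ⟨J, hJ, hJ2⟩ := (h0 c hc0).mp hone
  rw [hcJ J hJ] at hJ2
  unfold soloBlindIndVec at hJ2
  split_ifs at hJ2 <;> revert hJ2 <;> decide

/-- REALISATION THEOREM FOR (K₃): the Kraft inequality `soloBlindMass ≤ 1` for all zero-sum-free sequences in
exponent-`3` groups (index types and groups in the universe of `W`) implies the balanced hypergraph Kraft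
conjecture over `W`. -/
theorem soloBlind_hgKraftOne_of_kraft
    (hK : ∀ {κ : Type u} {G' : Type u} [AddCommGroup G'] [DecidableEq G'],
      (∀ g : G', g + g + g = 0) → ∀ (h' : κ → G') (S' : Finset κ),
      (∀ T ⊆ S', T.Nonempty → ∑ i ∈ T, h' i ≠ 0) → ∀ τ' : G', soloBlindMass h' S' τ' ≤ 1) :
    soloBlindHgKraftOneConj W := by
  classical
  intro F P hPF hbal
  obtain ⟨hsep, h0⟩ := hbal
  by_cases hF : F = ∅
  · subst hF; simp [soloBlindHgKraft]
  obtain ⟨v₀, hv₀⟩ := Finset.nonempty_iff_ne_empty.mpr hF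
  set L := soloBlindRelMod F P v₀ with hL
  let h : Finset W → (Finset W → ZMod 3) ⧸ L := soloBlindRealise F P v₀
  set σ : (Finset W → ZMod 3) ⧸ L := L.mkQ (soloBlindStarVec P v₀) with hσ
  have zsf : ∀ T ⊆ P, T.Nonempty → ∑ J ∈ T, h J ≠ 0 := soloBlind_realise_zsf hPF hv₀ h0
  -- the Kraft inequality for the realisation at σ
  have hmass := hK (soloBlind_quotMod_three L) h P zsf σ
  -- the stars are distinct representations of σ
  have star_rep : ∀ v ∈ F, P.filter (fun J => v ∈ J) ∈ soloBlindSeqRepAll h P σ := by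
    intro v hv
    rw [soloBlind_mem_seqRepAll]
    refine ⟨Finset.filter_subset _ _, ?_⟩
    rw [hσ, soloBlind_realise_sum, soloBlind_indVec_star, Submodule.mkQ_apply, Submodule.mkQ_apply,
      Submodule.Quotient.eq]
    exact Submodule.subset_span ⟨⟨v, hv⟩, rfl⟩
  have star_inj : ∀ v ∈ F, ∀ w ∈ F, P.filter (fun J => v ∈ J) = P.filter (fun J => w ∈ J) → v = w := by
    intro v hv w hw hvw
    by_contra hne
    obtain ⟨J, hJ, hJsep⟩ := hsep v hv w hw hne
    apply hJsep
    constructor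
    · intro hvJ
      have : J ∈ P.filter (fun J => w ∈ J) := hvw ▸ Finset.mem_filter.mpr ⟨hJ, hvJ⟩
      exact (Finset.mem_filter.mp this).2
    · intro hwJ
      have : J ∈ P.filter (fun J => v ∈ J) := hvw.symm ▸ Finset.mem_filter.mpr ⟨hJ, hwJ⟩
      exact (Finset.mem_filter.mp this).2
  calc soloBlindHgKraft F P
      = ∑ T ∈ F.image (fun v => P.filter (fun J => v ∈ J)), (1 / 2 : ℚ) ^ T.card := by
        unfold soloBlindHgKraft soloBlindHgDeg
        rw [Finset.sum_image (fun v hv w hw hvw => star_inj v hv w hw hvw)]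
    _ ≤ soloBlindMass h P σ := by
        unfold soloBlindMass
        apply Finset.sum_le_sum_of_subset_of_nonneg
        · intro T hT
          obtain ⟨v, hv, rfl⟩ := Finset.mem_image.mp hT
          exact star_rep v hv
        · intro T _ _; positivity
    _ ≤ 1 := hmass

/-- EQUIVALENCE (at matching universes): the Kraft inequality (K₃) for all zero-sum-free sequences in
exponent-`3` groups of `Type u` holds iff the balanced hypergraph Kraft conjecture holds over every vertex type
in `Type u`. -/
theorem soloBlind_kraft_iff_hgKraftOne :
    (∀ {κ : Type u} {G' : Type u} [AddCommGroup G'] [DecidableEq G'],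
      (∀ g : G', g + g + g = 0) → ∀ (h' : κ → G') (S' : Finset κ),
      (∀ T ⊆ S', T.Nonempty → ∑ i ∈ T, h' i ≠ 0) → ∀ τ' : G', soloBlindMass h' S' τ' ≤ 1) ↔
    (∀ {W' : Type u} [DecidableEq W'], soloBlindHgKraftOneConj W') := by
  constructor
  · intro hK W' _
    exact soloBlind_hgKraftOne_of_kraft hK
  · intro hC κ G' _ _ three h' S' zsf' τ'
    classical
    exact soloBlind_kraft_of_hgKraftOne hC three h' S' zsf' τ'

/-- COROLLARY: the two hypergraph conjectures are equivalent to each other (through E ⟺ (K₃)):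
(♣) over all vertex types of `Type u` iff (♦) over all vertex types of `Type u`. -/
theorem soloBlind_hgKraft_iff_hgKraftOne :
    (∀ {W' : Type u} [DecidableEq W'], soloBlindHgKraftConj W') ↔
    (∀ {W' : Type u} [DecidableEq W'], soloBlindHgKraftOneConj W') := by
  constructor
  · intro hC W' _
    apply soloBlind_hgKraftOne_of_kraft
    intro κ G' _ _ three h' S' zsf' τ'
    classical
    exact soloBlind_kraft_of_hgKraft (fun {κ'} _ => hC) three h' S' zsf' τ'
  · intro hC W' _
    apply soloBlind_hgKraft_of_conjE
    intro κ G' _ _ three h' S' τ' zsf' hgood'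
    classical
    exact soloBlind_conjE_of_hgKraftOne (fun {κ'} _ => hC) three h' S' zsf' τ' hgood'

end Summit.MatrixMultiplication.MatrixMultiplication.Theorems
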